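import Summits.Ventures.YMGap.RobustBall.HeatBathPoincareZd
import HarnessLib

/-!
# Robust ball (Y2) — THE HEAT-BATH POINCARÉ INEQUALITY OF EVERY INFINITE-VOLUME GIBBS STATE of strong-coupling `SU(N)` lattice
# Yang–Mills on `ℤ^d`, on the Kantorovich–Rubinstein window of the one-link modulus

HONEST FRAMING: venture file of the cell `pub-ymgap` (QuantumFields programme), track ROBUST-BALL, seat rb-p2 (g12).  LATTICE statements at
strong coupling; nothing here concerns the continuum limit or the Clay problem.  The DLR sequel of `HeatBathPoincareZd.lean`:
* `gibbsVariance_le_of_oneLinkKRModulus` — for the Wilson specification `γ` of `SU(N)` on `ℤ^d` at bare coupling `N β`, `OneLinkKRModulus N R K`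
  on `‖B‖_op ≤ R ⊇ 2(d−1)|β|`, and `6(d−1)|β| K ≤ c < 1`: EVERY DLR state `μ ∈ 𝒢(γ)` and every Lipschitz cylinder `F` on the links `Δ` satisfy
  `Var_μ(F) ≤ (2(1−c))⁻¹ ∑_{x ∈ Δ} ∫ (∫ (F(U) − F(σ))² γ_{x}(dσ|U)) μ(dU)` — the infinite-volume single-link heat-bath dynamics has spectral gap
  `≥ 1 − c` on local Lipschitz observables.  Proof: the law of total variance through the DLR equations (`GibbsStrongMarkov.setIntegral_integral_spec`),
  the kernel inequality of `HeatBathPoincareZd` on the boxes `boxLinks d (n + m₀) ⊇ Δ` uniformly in the boundary field, vanishing of the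
  conditional-variance functional off `Δ`, and the seat's boundary insensitivity `BoundaryDecayKR.abs_boundary_sub_integral_le_of_oneLinkKRModulus`
  on the SAME window (`(max c ½)^{2n} → 0` kills the boundary term).
* `su2_gibbsVariance_le` — `SU(2)`, `d = 4`, HYPOTHESIS-FREE on `0 ≤ β_W < 2/9` (tree coupling `β_W/2`), constant `(2 − 9β_W)⁻¹`, for every DLR state
  (on this window the DLR state is unique, `StarUniquenessZd`; the inequality does not use uniqueness); `su2_gibbsVariance_le_heatBath` — the same with
  the explicit one-link heat baths `ν_x^U = Haar.tilted(−(β_W/2) S_{x}(U[x ↦ ·]))` (`integral_sq_sub_eq_heatBath`), the form of `HeatBathPoincare.lean`.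
* `gibbsVariance_le_sum_osc_sq` — OSCILLATION FORM: `Var_μ(F) ≤ (2(1−c))⁻¹ ∑_{x ∈ Δ} δ_x²` for one-link oscillations `δ_x` — the variance of an
  additive local observable is extensive, uniformly over the DLR states (`integral_sq_sub_le_sq`).
* `abs_box_sub_integral_le` — the every-`N` Wilson boundary insensitivity through the KR door (the seat's `BoundaryDecayKR` at the zero perturbation).
References: L. Wu, Ann. Inst. Fourier 56 (2006); H. Föllmer, LNM 1362 (1988) Ch. I; H.-O. Georgii (2011) Rem. 1.24, Thm. 8.20;
D. W. Stroock, B. Zegarlinski, CMP 144 (1992) (Dobrushin uniqueness ⇒ infinite-volume Poincaré / log-Sobolev, the classical-spin analogue).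
-/

noncomputable section

open MeasureTheory Function Real Filter Finset ProbabilityTheory Topology
open scoped ENNReal NNReal
open Literature.Probability.LatticeModels
open Literature.Probability.LatticeModels.DobrushinMetric
open Literature.MathematicalPhysics.QuantumLattice
open Literature.MathematicalPhysics.QuantumFieldTheory hiding ZdEdge
open Literature.MathematicalPhysics.QuantumFieldTheory.Balaban1983to89.StrongCouplingDobrushinWindow (OneLinkKRModulus)

namespace Summit.Ventures.YMGap.RobustBall.HeatBathPoincareZd

variable {d N : ℕ}

/-! ### Tools: kernel integrals, bias–variance, vanishing off the support, boxes -/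

section Tools

variable {S : Type*} [MeasurableSpace S] {ι : Type*}

/-- `ω ↦ ∫ f dγ_Λ(·|ω)` is measurable for measurable `f` (the kernels of a specification are measurable). [folklore] -/
theorem measurable_integral_spec {γ : Specification ι S} (hγ : IsSpecification γ) (Λ : Finset ι) {f : (ι → S) → ℝ}
    (hf : Measurable f) : Measurable fun η => ∫ σ, f σ ∂(γ Λ η) := by
  let κ : Kernel (ι → S) (ι → S) := ⟨γ Λ, hγ.measurable_fun Λ⟩
  exact (hf.stronglyMeasurable.integral_kernel (κ := κ)).measurable

/-- The integral of a function with values in `[0, B]` against a probability measure lies in `[0, B]`. [folklore] -/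
theorem abs_integral_le_of_nonneg_of_le {Ω : Type*} [MeasurableSpace Ω] {ν : Measure Ω} [IsProbabilityMeasure ν] {g : Ω → ℝ}
    {B : ℝ} (h0 : ∀ ω, 0 ≤ g ω) (hB : ∀ ω, g ω ≤ B) : |∫ ω, g ω ∂ν| ≤ B := by
  rw [abs_of_nonneg (integral_nonneg h0)]
  have h := integral_mono_of_nonneg (μ := ν) (ae_of_all _ h0) (integrable_const B) (ae_of_all _ hB)
  simpa using h

/-- **Bias–variance**: `∫ (F − m)² dν = Var_ν(F) + (∫ F dν − m)²` for a probability measure and a bounded measurable `F`. [folklore] -/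
theorem integral_sq_sub_const_eq {Ω : Type*} [MeasurableSpace Ω] {ν : Measure Ω} [IsProbabilityMeasure ν] {F : Ω → ℝ}
    (hF : Measurable F) {M : ℝ} (hM : ∀ ω, |F ω| ≤ M) (m : ℝ) :
    ∫ ω, (F ω - m) ^ 2 ∂ν = ProbabilityTheory.variance F ν + (∫ ω, F ω ∂ν - m) ^ 2 := by
  have hi : Integrable F ν := Integrable.of_bound hF.aestronglyMeasurable M
    (ae_of_all _ fun ω => by rw [Real.norm_eq_abs]; exact hM ω)
  have hi2 : Integrable (fun ω => F ω ^ 2) ν :=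
    Integrable.of_bound (hF.pow_const 2).aestronglyMeasurable (M ^ 2) (ae_of_all _ fun ω => by
      rw [Real.norm_eq_abs, abs_pow]; exact pow_le_pow_left₀ (abs_nonneg _) (hM ω) 2)
  have hmem : MemLp F 2 ν := memLp_of_bounded (a := -M) (b := M)
    (ae_of_all _ fun ω => ⟨(abs_le.1 (hM ω)).1, (abs_le.1 (hM ω)).2⟩) hF.aestronglyMeasurable 2
  rw [ProbabilityTheory.variance_eq_sub hmem]
  have h1 : (fun ω => (F ω - m) ^ 2) = fun ω => (F ω ^ 2 - 2 * m * F ω) + m ^ 2 := by funext ω; ring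
  have hA : ∫ ω, (F ω ^ 2 - 2 * m * F ω) + m ^ 2 ∂ν = (∫ ω, F ω ^ 2 - 2 * m * F ω ∂ν) + ∫ _ω, m ^ 2 ∂ν :=
    integral_add (hi2.sub (hi.const_mul _)) (integrable_const _)
  have hB : ∫ ω, F ω ^ 2 - 2 * m * F ω ∂ν = (∫ ω, F ω ^ 2 ∂ν) - ∫ ω, 2 * m * F ω ∂ν := integral_sub hi2 (hi.const_mul _)
  have hC : ∫ ω, 2 * m * F ω ∂ν = 2 * m * ∫ ω, F ω ∂ν := integral_const_mul _ _
  have hD : ∫ _ω, m ^ 2 ∂ν = m ^ 2 := by simp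
  rw [h1, hA, hB, hC, hD]
  simp only [Pi.pow_apply]
  ring

/-- **Off the support the conditional-variance functional vanishes**: if `F` does not read the link `x`, then
`∫ (F(η) − F(σ))² γ_{x}(dσ|η) = 0` (properness). [folklore] -/
theorem integral_sq_sub_eq_zero [DecidableEq ι] {γ : Specification ι S} (hγ : IsSpecification γ) {F : (ι → S) → ℝ}
    (hF : Measurable F) {Δ : Set ι} (hFd : DependsOn F Δ) {x : ι} (hx : x ∉ Δ) (η : ι → S) :
    ∫ σ, (F η - F σ) ^ 2 ∂(γ {x} η) = 0 := by
  have h2 := siteAvg_eq_integral_siteLaw hγ x (f := fun σ => (F η - F σ) ^ 2) ((measurable_const.sub hF).pow_const 2) η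
  unfold siteAvg at h2
  beta_reduce at h2
  rw [h2]
  have h3 : ∀ s, F (update η x s) = F η := fun s =>
    hFd fun i (hi : i ∈ Δ) => update_of_ne (fun h : i = x => hx (h ▸ hi)) _ _
  simp [h3]

/-- Every finite set of links lies in some box. [folklore] -/
theorem exists_subset_boxLinks (Δ : Finset (ZdEdge d)) : ∃ m : ℕ, Δ ⊆ boxLinks d m := by
  refine ⟨Δ.sup fun e => ⌈‖e.1‖⌉₊, fun e he => ?_⟩
  rw [mem_boxLinks, mem_siteBox_iff_norm]
  have h1 : ‖e.1‖ ≤ (⌈‖e.1‖⌉₊ : ℝ) := Nat.le_ceil _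
  have h2 : (⌈‖e.1‖⌉₊ : ℕ) ≤ Δ.sup fun e => ⌈‖e.1‖⌉₊ := Finset.le_sup (f := fun e : ZdEdge d => ⌈‖e.1‖⌉₊) he
  exact h1.trans (by exact_mod_cast h2)

/-- Boxes of `ℤ^d`, `d ≥ 1`, are non-empty. [folklore] -/
theorem boxLinks_nonempty (hd : 1 ≤ d) (n : ℕ) : (boxLinks d n).Nonempty :=
  ⟨((0 : Site d), ⟨0, hd⟩), by rw [mem_boxLinks, mem_siteBox]; intro i; simp⟩

end Tools

/-! ### The boundary term: the Wilson point through the Kantorovich–Rubinstein door, every `N` -/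

section Boundary

/-- **Boundary insensitivity of every DLR state at the Wilson point, every `N`** (the seat's `BoundaryDecayKR` door with the zero perturbation):
on the window `6(d−1)|β|K ≤ c < 1`, for the box `boxLinks d (n + m)`, ANY boundary field `ω` and a Lipschitz cylinder on links in `boxLinks d m`,
`|∫ F dγ_{box}(·|ω) − ∫ F dμ| ≤ 2√N · K_F · #Δ · (max c ½)^n`. [folklore] -/
theorem abs_box_sub_integral_le (hd : 1 ≤ d) (hN : 1 ≤ N) {β R K c : ℝ} (hK : 0 ≤ K)
    (hR : |β| * (2 * ((d : ℝ) - 1)) ≤ R) (hmod : OneLinkKRModulus N R K) (hc : 6 * ((d : ℝ) - 1) * |β| * K ≤ c) (hc1 : c < 1)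
    {μ : Measure (LGConfig d (Matrix.specialUnitaryGroup (Fin N) ℂ))}
    (hμ : μ ∈ ymGibbsMeasures (d := d) (fundamentalRep (Fin N)) (N * β)) {m : ℕ} (n : ℕ)
    (ω : LGConfig d (Matrix.specialUnitaryGroup (Fin N) ℂ))
    {F : LGConfig d (Matrix.specialUnitaryGroup (Fin N) ℂ) → ℝ} {Δ : Finset (ZdEdge d)} {KF : ℝ≥0}
    (hF : IsLipschitzCylinder (fundamentalRep (Fin N)) F Δ KF) (hΔ : Δ ⊆ boxLinks d m) :
    |(∫ U, F U ∂(ymSpecification (d := d) (fundamentalRep (Fin N)) (N * β) (boxLinks d (n + m)) ω)) - ∫ U, F U ∂μ| ≤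
      2 * Real.sqrt N * KF * Δ.card * (max c (1 / 2)) ^ n := by
  classical
  set supp : Finset (ZdEdge d) → Finset (Finset (ZdEdge d)) := fun _ => ∅ with hsupp
  have hμ' : μ ∈ perturbedGibbsMeasures (d := d) (fundamentalRep (Fin N)) (N * β) 0 supp := by
    rwa [perturbedGibbsMeasures_zero]
  have hD : ∀ y ∈ Δ, ∀ z, z ∉ boxLinks d (n + m) → (n : ℝ) ≤ ‖y.1 - z.1‖ := fun y hy z hz => by
    have h := sub_le_norm_sub_of_mem_boxLinks (hΔ hy) hz
    push_cast at h
    linarith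
  have key := abs_boundary_sub_integral_le_of_oneLinkKRModulus hd hN (β := β) (b := R) (K := K) (a := 0) (ℓs := 0) (Λ := 0) (R := 0)
    (ρ := c) hK le_rfl hR hmod (W := 0) (supp := supp) (fun _ => continuous_const) (fun _ _ _ _ => rfl) (fun _ _ _ h => (h rfl).elim)
    (osc := fun _ _ => 0) (fun _ => ⟨fun _ => le_rfl, fun _ _ _ _ => by simp⟩) (fun _ => by simp [hsupp])
    (lip := fun _ _ => 0) (fun _ => ⟨fun _ => le_rfl, fun _ _ _ _ => by simp⟩) (fun _ => by simp [hsupp])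
    (fun _ => by simp [hsupp]) (fun _ _ h => by simp [hsupp] at h)
    (by simp only [Real.exp_zero, mul_one, mul_zero, add_zero]; exact hc) hc1 hμ' (boxLinks d (n + m)) ω hF hD
  rw [perturbedYM_zero, max_eq_left (zero_le_one : (0 : ℝ) ≤ 1), div_one, Nat.floor_natCast] at key
  exact key

end Boundary

/-! ### The Poincaré inequality of every infinite-volume Gibbs state -/

section Gibbs

/-- Boxes grow with their radius. [folklore] -/
theorem boxLinks_subset_boxLinks {m n : ℕ} (h : m ≤ n) : boxLinks d m ⊆ boxLinks d n := fun e he => by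
  rw [mem_boxLinks, mem_siteBox] at he ⊢
  exact fun i => (he i).trans (by exact_mod_cast h)

/-- ★★★ **THE HEAT-BATH POINCARÉ INEQUALITY OF EVERY INFINITE-VOLUME GIBBS STATE** (`SU(N)` lattice Yang–Mills on `ℤ^d`, bare coupling `N β`).
If `2(d−1)|β| ≤ R`, `OneLinkKRModulus N R K` (`K ≥ 0`) and `6(d−1)|β| K ≤ c < 1`, then EVERY DLR state `μ` of the Wilson specification `γ` and every
Lipschitz cylinder `F` on the links `Δ` satisfy
`Var_μ(F) ≤ (2(1−c))⁻¹ ∑_{x ∈ Δ} ∫ (∫ (F(U) − F(σ))² γ_{x}(dσ|U)) μ(dU)`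
— the infinite-volume single-link heat-bath (Glauber) dynamics has spectral gap `≥ 1 − c` on local Lipschitz observables (law of total variance
through the DLR equations + the kernel inequality on boxes uniformly in the boundary field + boundary insensitivity on the same window;
Stroock–Zegarlinski 1992 is the classical-spin analogue). [folklore] -/
theorem gibbsVariance_le_of_oneLinkKRModulus (hd : 1 ≤ d) (hN : 1 ≤ N) {β R K c : ℝ} (hK : 0 ≤ K)
    (hR : |β| * (2 * ((d : ℝ) - 1)) ≤ R) (hmod : OneLinkKRModulus N R K) (hc : 6 * ((d : ℝ) - 1) * |β| * K ≤ c) (hc1 : c < 1)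
    {μ : Measure (LGConfig d (Matrix.specialUnitaryGroup (Fin N) ℂ))}
    (hμ : μ ∈ ymGibbsMeasures (d := d) (fundamentalRep (Fin N)) (N * β))
    {F : LGConfig d (Matrix.specialUnitaryGroup (Fin N) ℂ) → ℝ} {Δ : Finset (ZdEdge d)} {KF : ℝ≥0}
    (hF : IsLipschitzCylinder (fundamentalRep (Fin N)) F Δ KF) :
    ProbabilityTheory.variance F μ ≤
      (2 * (1 - c))⁻¹ * ∑ x ∈ Δ, ∫ U, ∫ σ, (F U - F σ) ^ 2 ∂(ymSpecification (fundamentalRep (Fin N)) (N * β) {x} U) ∂μ := by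
  haveI : SecondCountableTopology (Matrix (Fin N) (Fin N) ℂ) :=
    inferInstanceAs (SecondCountableTopology (Fin N → Fin N → ℂ))
  haveI : SecondCountableTopology (Matrix.specialUnitaryGroup (Fin N) ℂ) :=
    Topology.IsEmbedding.subtypeVal.secondCountableTopology
  set γ := ymSpecification (d := d) (fundamentalRep (Fin N)) (N * β) with hγdef
  have hγ : IsSpecification γ := isSpecification_ymSpecification_of_t2Space _ (continuous_fundamentalRep (Fin N)) _
  have hμ' : IsGibbsMeasure γ μ := hμ
  haveI := hμ'.isProbabilityMeasure
  have hFm : Measurable F := hF.measurable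
  have hM : ∀ U, |F U| ≤ |F 1| + 2 * KF := hF.abs_le
  set M : ℝ := |F 1| + 2 * KF with hMdef
  obtain ⟨m₀, hm₀⟩ := exists_subset_boxLinks Δ
  have hlt : 0 < 2 * (1 - c) := by linarith
  set r : ℝ := max c (1 / 2) with hr
  have hr0 : 0 ≤ r := le_max_of_le_right (by norm_num)
  have hr1 : r < 1 := max_lt hc1 (by norm_num)
  set E : ℝ := 2 * Real.sqrt N * KF * Δ.card with hE
  -- the conditional-variance functional
  set h : ZdEdge d → LGConfig d (Matrix.specialUnitaryGroup (Fin N) ℂ) → ℝ := fun x U => ∫ σ, (F U - F σ) ^ 2 ∂(γ {x} U) with hh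
  have hhm : ∀ x, Measurable (h x) := fun x => measurable_integral_sq_sub hγ x hFm hM
  have hhb : ∀ x U, |h x U| ≤ 4 * M ^ 2 := fun x U => abs_integral_sq_sub_le hγ x hM U
  have hhnn : ∀ x U, 0 ≤ h x U := fun x U => integral_nonneg fun σ => sq_nonneg _
  have hh0 : ∀ x, x ∉ Δ → ∀ U, h x U = 0 := fun x hx U =>
    integral_sq_sub_eq_zero hγ hFm hF.dependsOn (fun h' => hx (Finset.mem_coe.1 h')) U
  -- the estimate on the box of radius `n + m₀`, for every `n`
  have claim : ∀ n : ℕ, ProbabilityTheory.variance F μ ≤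
      (2 * (1 - c))⁻¹ * ∑ x ∈ Δ, ∫ U, h x U ∂μ + E ^ 2 * (r ^ 2) ^ n := by
    intro n
    set V := boxLinks d (n + m₀) with hV
    have hΔV : Δ ⊆ V := hm₀.trans (boxLinks_subset_boxLinks (Nat.le_add_left m₀ n))
    have hVne : V.Nonempty := boxLinks_nonempty hd _
    set mval := ∫ U, F U ∂μ with hmval
    -- (1) the law of total variance through the DLR equations
    have h1 : ProbabilityTheory.variance F μ = ∫ ω, ∫ σ, (F σ - mval) ^ 2 ∂(γ V ω) ∂μ := by
      rw [ProbabilityTheory.variance_eq_integral hFm.aemeasurable]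
      have hsq_m : Measurable fun σ => (F σ - mval) ^ 2 := (hFm.sub measurable_const).pow_const 2
      have hsq_b : ∀ σ, |(F σ - mval) ^ 2| ≤ (M + |mval|) ^ 2 := fun σ => by
        rw [abs_pow]
        exact pow_le_pow_left₀ (abs_nonneg _) ((abs_sub _ _).trans (add_le_add (hM σ) le_rfl)) 2
      have key := hμ'.setIntegral_integral_spec hγ V (B := Set.univ) MeasurableSet.univ hsq_m hsq_b
      simp only [Measure.restrict_univ] at key
      exact key.symm
    -- (2) the pointwise bound on the kernel side: kernel Poincaré + boundary insensitivity
    have h2 : ∀ ω, ∫ σ, (F σ - mval) ^ 2 ∂(γ V ω) ≤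
        (2 * (1 - c))⁻¹ * ∑ x ∈ Δ, ∫ U, h x U ∂(γ V ω) + E ^ 2 * (r ^ 2) ^ n := by
      intro ω
      haveI := hγ.isProbability V ω
      rw [integral_sq_sub_const_eq hFm hM mval]
      have hA : ProbabilityTheory.variance F (γ V ω) ≤ (2 * (1 - c))⁻¹ * ∑ x ∈ V, ∫ U, h x U ∂(γ V ω) :=
        kernelVariance_le_of_oneLinkKRModulus hd hN hK hR hmod hc hc1 hVne ω hFm ⟨M, hM⟩
      have hsum : ∑ x ∈ V, ∫ U, h x U ∂(γ V ω) = ∑ x ∈ Δ, ∫ U, h x U ∂(γ V ω) := by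
        rw [← Finset.sum_subset hΔV]
        intro x _ hx
        simp [hh0 x hx]
      have hB : (∫ U, F U ∂(γ V ω) - mval) ^ 2 ≤ E ^ 2 * (r ^ 2) ^ n := by
        have hb : |(∫ U, F U ∂(γ V ω)) - mval| ≤ E * r ^ n := abs_box_sub_integral_le hd hN hK hR hmod hc hc1 hμ n ω hF hm₀
        calc (∫ U, F U ∂(γ V ω) - mval) ^ 2 = |(∫ U, F U ∂(γ V ω)) - mval| ^ 2 := (sq_abs _).symm
          _ ≤ (E * r ^ n) ^ 2 := pow_le_pow_left₀ (abs_nonneg _) hb 2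
          _ = E ^ 2 * (r ^ 2) ^ n := by ring
      calc ProbabilityTheory.variance F (γ V ω) + (∫ U, F U ∂(γ V ω) - mval) ^ 2
          ≤ (2 * (1 - c))⁻¹ * ∑ x ∈ V, ∫ U, h x U ∂(γ V ω) + E ^ 2 * (r ^ 2) ^ n := add_le_add hA hB
        _ = (2 * (1 - c))⁻¹ * ∑ x ∈ Δ, ∫ U, h x U ∂(γ V ω) + E ^ 2 * (r ^ 2) ^ n := by rw [hsum]
    -- (3) integrate over `μ`
    have hint : ∀ x, Integrable (fun ω => ∫ U, h x U ∂(γ V ω)) μ := fun x =>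
      integrable_of_abs_le' (measurable_integral_spec hγ V (hhm x)) (M := 4 * M ^ 2) fun ω => by
        haveI := hγ.isProbability V ω
        exact abs_integral_le_of_nonneg_of_le (hhnn x) fun U => (abs_le.1 (hhb x U)).2
    have hsum_int : Integrable (fun ω => ∑ x ∈ Δ, ∫ U, h x U ∂(γ V ω)) μ := integrable_finsetSum _ fun x _ => hint x
    have h3 : ∫ ω, ∫ σ, (F σ - mval) ^ 2 ∂(γ V ω) ∂μ ≤
        ∫ ω, ((2 * (1 - c))⁻¹ * ∑ x ∈ Δ, ∫ U, h x U ∂(γ V ω) + E ^ 2 * (r ^ 2) ^ n) ∂μ :=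
      integral_mono_of_nonneg (ae_of_all _ fun ω => integral_nonneg fun σ => sq_nonneg _)
        ((hsum_int.const_mul _).add (integrable_const _)) (ae_of_all _ h2)
    -- (4) evaluate the right-hand side with the DLR equations
    have hDLR : ∀ x, ∫ ω, ∫ U, h x U ∂(γ V ω) ∂μ = ∫ U, h x U ∂μ := fun x => by
      have key := hμ'.setIntegral_integral_spec hγ V (B := Set.univ) MeasurableSet.univ (hhm x) (hhb x)
      simp only [Measure.restrict_univ] at key
      exact key
    have h4 : ∫ ω, ((2 * (1 - c))⁻¹ * ∑ x ∈ Δ, ∫ U, h x U ∂(γ V ω) + E ^ 2 * (r ^ 2) ^ n) ∂μ =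
        (2 * (1 - c))⁻¹ * ∑ x ∈ Δ, ∫ U, h x U ∂μ + E ^ 2 * (r ^ 2) ^ n := by
      have hc' : ∫ _ω, E ^ 2 * (r ^ 2) ^ n ∂μ = E ^ 2 * (r ^ 2) ^ n := by simp
      rw [integral_add (hsum_int.const_mul _) (integrable_const _), integral_const_mul, integral_finsetSum _ (fun x _ => hint x), hc']
      simp_rw [hDLR]
    calc ProbabilityTheory.variance F μ = _ := h1
      _ ≤ _ := h3
      _ = _ := h4
  -- (5) `n → ∞`
  have hr2 : r ^ 2 < 1 := pow_lt_one₀ hr0 hr1 two_ne_zero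
  have hlim : Tendsto (fun n : ℕ => (2 * (1 - c))⁻¹ * ∑ x ∈ Δ, ∫ U, h x U ∂μ + E ^ 2 * (r ^ 2) ^ n) atTop
      (𝓝 ((2 * (1 - c))⁻¹ * ∑ x ∈ Δ, ∫ U, h x U ∂μ + E ^ 2 * 0)) :=
    tendsto_const_nhds.add ((tendsto_pow_atTop_nhds_zero_of_lt_one (pow_nonneg hr0 2) hr2).const_mul _)
  rw [mul_zero, add_zero] at hlim
  exact le_of_tendsto_of_tendsto' tendsto_const_nhds hlim claim

/-- ★★★ **`SU(2)`, `d = 4`, HYPOTHESIS-FREE on `0 ≤ β_W < 2/9`** (tree coupling `β_W/2`, quarter modulus): EVERY DLR state `μ` of 4D `SU(2)` lattice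
Yang–Mills and every Lipschitz cylinder `F` on the links `Δ` satisfy
`Var_μ(F) ≤ (2 − 9β_W)⁻¹ ∑_{x ∈ Δ} ∫ (∫ (F(U) − F(σ))² γ_{x}(dσ|U)) μ(dU)` — the infinite-volume heat-bath dynamics has spectral gap `≥ 1 − 9β_W/2`
on local Lipschitz observables (the DLR state is unique on this window, but uniqueness is not used). [folklore] -/
theorem su2_gibbsVariance_le {βW : ℝ} (h0 : 0 ≤ βW) (h : βW < 2 / 9)
    {μ : Measure (LGConfig 4 (Matrix.specialUnitaryGroup (Fin 2) ℂ))}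
    (hμ : μ ∈ ymGibbsMeasures (d := 4) (fundamentalRep (Fin 2)) (βW / 2))
    {F : LGConfig 4 (Matrix.specialUnitaryGroup (Fin 2) ℂ) → ℝ} {Δ : Finset (ZdEdge 4)} {KF : ℝ≥0}
    (hF : IsLipschitzCylinder (fundamentalRep (Fin 2)) F Δ KF) :
    ProbabilityTheory.variance F μ ≤
      (2 - 9 * βW)⁻¹ * ∑ x ∈ Δ, ∫ U, ∫ σ, (F U - F σ) ^ 2 ∂(ymSpecification (fundamentalRep (Fin 2)) (βW / 2) {x} U) ∂μ := by
  have hβ : ((2 : ℕ) : ℝ) * (βW / 4) = βW / 2 := by push_cast; ring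
  have habs : |βW / 4| = βW / 4 := abs_of_nonneg (by positivity)
  have hμ4 : μ ∈ ymGibbsMeasures (d := 4) (fundamentalRep (Fin 2)) ((2 : ℕ) * (βW / 4)) := by rwa [hβ]
  have key := gibbsVariance_le_of_oneLinkKRModulus (d := 4) (N := 2) (by norm_num) (by norm_num) (β := βW / 4) (R := 3 * βW / 2)
    zero_le_one (by rw [habs]; norm_num; linarith) (SlabAreaLawDimensions.su2_oneLinkKRModulus_of_le_one (by linarith)) (c := 9 * βW / 2)
    (by rw [habs]; norm_num; linarith) (by linarith) hμ4 hF
  have e : (2 * (1 - 9 * βW / 2))⁻¹ = (2 - 9 * βW)⁻¹ := by congr 1; ring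
  rw [hβ, e] at key
  exact key

end Gibbs

/-! ### The same inequality with the explicit one-link heat baths `ν_x^U = Haar.tilted(−β' S_{x}(U[x ↦ ·]))` -/

section HeatBathForm

/-- The conditional-variance functional through the one-link heat bath: `∫ (F(U) − F(σ))² γ_{x}(dσ|U) = ∫ (F(U) − F(U[x ↦ g]))² ν_x^U(dg)`,
`ν_x^U = Haar.tilted(−β' S_{x}(U[x ↦ ·]))` (properness of the one-link kernel). [folklore] -/
theorem integral_sq_sub_eq_heatBath (β' : ℝ) (x : ZdEdge d) {F : LGConfig d (Matrix.specialUnitaryGroup (Fin N) ℂ) → ℝ}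
    (hF : Measurable F) (U : LGConfig d (Matrix.specialUnitaryGroup (Fin N) ℂ)) :
    ∫ σ, (F U - F σ) ^ 2 ∂(ymSpecification (fundamentalRep (Fin N)) β' {x} U) =
      ∫ g, (F U - F (update U x g)) ^ 2 ∂((haarProbability (Matrix.specialUnitaryGroup (Fin N) ℂ)).tilted
        fun g => -β' * wilsonBoundaryAction (fundamentalRep (Fin N)) {x} (update U x g)) := by
  haveI : SecondCountableTopology (Matrix (Fin N) (Fin N) ℂ) :=
    inferInstanceAs (SecondCountableTopology (Fin N → Fin N → ℂ))
  haveI : SecondCountableTopology (Matrix.specialUnitaryGroup (Fin N) ℂ) :=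
    Topology.IsEmbedding.subtypeVal.secondCountableTopology
  have hγ : IsSpecification (ymSpecification (d := d) (fundamentalRep (Fin N)) β') :=
    isSpecification_ymSpecification_of_t2Space _ (continuous_fundamentalRep (Fin N)) _
  have h2 := siteAvg_eq_integral_siteLaw hγ x (f := fun σ => (F U - F σ) ^ 2) ((measurable_const.sub hF).pow_const 2) U
  unfold siteAvg at h2
  beta_reduce at h2
  rw [h2, siteLaw_ymSpecification_eq_tilted_haar _ (continuous_fundamentalRep (Fin N))]

/-- ★★★ **`SU(2)`, `d = 4`, `0 ≤ β_W < 2/9`, HEAT-BATH FORM**: for EVERY DLR state `μ` and every Lipschitz cylinder `F` on the links `Δ`,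
`Var_μ(F) ≤ (2 − 9β_W)⁻¹ ∑_{x ∈ Δ} ∫∫ (F(U) − F(U[x ↦ g]))² ν_x^U(dg) μ(dU)` with the one-link heat baths `ν_x^U = Haar.tilted(−(β_W/2) S_{x}(U[x ↦ ·]))`
— the Dirichlet form of the single-link heat-bath dynamics of 4D `SU(2)` lattice Yang–Mills in INFINITE volume dominates the variance with the
volume-free constant `(2 − 9β_W)⁻¹` (compare `HeatBathPoincare.su2_heatBathPoincare` on the tori). [folklore] -/
theorem su2_gibbsVariance_le_heatBath {βW : ℝ} (h0 : 0 ≤ βW) (h : βW < 2 / 9)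
    {μ : Measure (LGConfig 4 (Matrix.specialUnitaryGroup (Fin 2) ℂ))}
    (hμ : μ ∈ ymGibbsMeasures (d := 4) (fundamentalRep (Fin 2)) (βW / 2))
    {F : LGConfig 4 (Matrix.specialUnitaryGroup (Fin 2) ℂ) → ℝ} {Δ : Finset (ZdEdge 4)} {KF : ℝ≥0}
    (hF : IsLipschitzCylinder (fundamentalRep (Fin 2)) F Δ KF) :
    ProbabilityTheory.variance F μ ≤
      (2 - 9 * βW)⁻¹ * ∑ x ∈ Δ, ∫ U, ∫ g, (F U - F (update U x g)) ^ 2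
        ∂((haarProbability (Matrix.specialUnitaryGroup (Fin 2) ℂ)).tilted
          fun g => -(βW / 2) * wilsonBoundaryAction (fundamentalRep (Fin 2)) {x} (update U x g)) ∂μ := by
  have key := su2_gibbsVariance_le h0 h hμ hF
  simp_rw [integral_sq_sub_eq_heatBath (βW / 2) _ hF.measurable] at key
  exact key

end HeatBathForm

/-! ### The oscillation form: the variance of a local observable is controlled by its one-link oscillations -/

section Oscillation

variable {S : Type*} [MeasurableSpace S] {ι : Type*}

/-- The conditional-variance functional is at most the squared one-link oscillation: if `|F(η) − F(η[x ↦ s])| ≤ δ` for all `s`, then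
`∫ (F(η) − F(σ))² γ_{x}(dσ|η) ≤ δ²` (properness). [folklore] -/
theorem integral_sq_sub_le_sq [DecidableEq ι] {γ : Specification ι S} (hγ : IsSpecification γ) (x : ι) {F : (ι → S) → ℝ}
    (hF : Measurable F) (η : ι → S) {δ : ℝ} (hδ : ∀ s, |F η - F (update η x s)| ≤ δ) :
    ∫ σ, (F η - F σ) ^ 2 ∂(γ {x} η) ≤ δ ^ 2 := by
  haveI := isProbabilityMeasure_siteLaw hγ x η
  have h2 := siteAvg_eq_integral_siteLaw hγ x (f := fun σ => (F η - F σ) ^ 2) ((measurable_const.sub hF).pow_const 2) η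
  unfold siteAvg at h2
  beta_reduce at h2
  rw [h2]
  have hb : ∀ s, (F η - F (update η x s)) ^ 2 ≤ δ ^ 2 := fun s => by
    rw [← sq_abs]; exact pow_le_pow_left₀ (abs_nonneg _) (hδ s) 2
  have h := integral_mono_of_nonneg (μ := siteLaw γ x η) (ae_of_all _ fun s => sq_nonneg (F η - F (update η x s)))
    (integrable_const (δ ^ 2)) (ae_of_all _ hb)
  simpa using h

/-- ★★ **OSCILLATION FORM**: on the window of `gibbsVariance_le_of_oneLinkKRModulus`, a Lipschitz cylinder `F` on `Δ` with one-link oscillations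
`|F(U) − F(U[x ↦ g])| ≤ δ_x` has `Var_μ(F) ≤ (2(1−c))⁻¹ ∑_{x ∈ Δ} δ_x²` in EVERY DLR state `μ` — the variance of an additive local observable is
EXTENSIVE (central-limit scaling), uniformly over the Gibbs states. [folklore] -/
theorem gibbsVariance_le_sum_osc_sq (hd : 1 ≤ d) (hN : 1 ≤ N) {β R K c : ℝ} (hK : 0 ≤ K)
    (hR : |β| * (2 * ((d : ℝ) - 1)) ≤ R) (hmod : OneLinkKRModulus N R K) (hc : 6 * ((d : ℝ) - 1) * |β| * K ≤ c) (hc1 : c < 1)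
    {μ : Measure (LGConfig d (Matrix.specialUnitaryGroup (Fin N) ℂ))}
    (hμ : μ ∈ ymGibbsMeasures (d := d) (fundamentalRep (Fin N)) (N * β))
    {F : LGConfig d (Matrix.specialUnitaryGroup (Fin N) ℂ) → ℝ} {Δ : Finset (ZdEdge d)} {KF : ℝ≥0}
    (hF : IsLipschitzCylinder (fundamentalRep (Fin N)) F Δ KF) (δ : ZdEdge d → ℝ)
    (hδ : ∀ x U g, |F U - F (update U x g)| ≤ δ x) :
    ProbabilityTheory.variance F μ ≤ (2 * (1 - c))⁻¹ * ∑ x ∈ Δ, δ x ^ 2 := by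
  haveI : SecondCountableTopology (Matrix (Fin N) (Fin N) ℂ) :=
    inferInstanceAs (SecondCountableTopology (Fin N → Fin N → ℂ))
  haveI : SecondCountableTopology (Matrix.specialUnitaryGroup (Fin N) ℂ) :=
    Topology.IsEmbedding.subtypeVal.secondCountableTopology
  have hγ : IsSpecification (ymSpecification (d := d) (fundamentalRep (Fin N)) (N * β)) :=
    isSpecification_ymSpecification_of_t2Space _ (continuous_fundamentalRep (Fin N)) _
  have hμ' : IsGibbsMeasure (ymSpecification (d := d) (fundamentalRep (Fin N)) (N * β)) μ := hμ
  haveI := hμ'.isProbabilityMeasure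
  have hC : 0 ≤ (2 * (1 - c))⁻¹ := by
    have : 0 < 2 * (1 - c) := by linarith
    positivity
  refine (gibbsVariance_le_of_oneLinkKRModulus hd hN hK hR hmod hc hc1 hμ hF).trans
    (mul_le_mul_of_nonneg_left (Finset.sum_le_sum fun x _ => ?_) hC)
  have hpt : ∀ U, ∫ σ, (F U - F σ) ^ 2 ∂(ymSpecification (d := d) (fundamentalRep (Fin N)) (N * β) {x} U) ≤ δ x ^ 2 := fun U =>
    integral_sq_sub_le_sq hγ x hF.measurable U (hδ x U)
  have h := integral_mono_of_nonneg (μ := μ) (ae_of_all _ fun U => integral_nonneg fun σ => sq_nonneg (F U - F σ))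
    (integrable_const (δ x ^ 2)) (ae_of_all _ hpt)
  simpa using h

end Oscillation

end Summit.Ventures.YMGap.RobustBall.HeatBathPoincareZd

end
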